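import Summits.CriticalPhenomena.PercolationContinuityZ3.Theorems.PercNearOneGluingNoHeavyLowerTailSahiFreeSlotFourData
import Summits.CriticalPhenomena.PercolationContinuityZ3.Theorems.PercNearOneGluingNoHeavyLowerTailSahiHittingMoments
import Summits.CriticalPhenomena.PercolationContinuityZ3.Theorems.SahiMasterFamilyCommonPivotal
import HarnessLib

/-!
# `NoHeavyLowerTail` (stmt-CriticalPhenomena-4575) — free-slot region reduction, MODEL SIDE: the open-region cells of three hitting events
# under a product measure, their masses, and the monotonicity of the free slot across cells

Support file, seat `prim-l12-p5` (gen 17), `--supports stmt-CriticalPhenomena-4575`.  Standard axioms, no sorries, no named facts.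
For `A : Fin 3 → Finset ι` and the product weight `bernoulliWeight p` on `Set ι` (memo FROM-prim-l12-p5-g17-FREE-SLOT-REGION-REDUCTION §1(ii)–(iii)):
* `ctype3`, `region` (the seven Venn regions, indexed by `SahiFreeSlot.regs`), `rho ω` (the set of regions containing an open coin), `rr` (region
  closed-probabilities `∏ (1 − p_c)`), `cellInd`;
* `hit_iff_mem_patt_rho` — `H_{A_j}` holds iff `j ∈ patt (rho ω)`: the three hit indicators factor through the cell map;
* `ex_cellInd` — **cell masses** `E[1_{rho = R}] = cellProb (rr p A) R = ∏_i (1 − rr_i | rr_i)` (inclusion–exclusion over disjoint regions);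
* `ex_mul_missInd_le` — **pinning**: `E[g·1_{S closed}] ≤ (∏_{c∈S}(1−p_c))·E[g]` whenever `g(ω) ≤ g(ω ∪ {c})` for `c ∈ S` (one coin at a time, `ex_update_eq`);
(The monotonicity of the free slot across cells and the assembly are in `…SahiFreeSlotFourMono`.) [this work]
-/

namespace Summit.CriticalPhenomena.PercolationContinuityZ3.Theorems

namespace SahiFreeSlot

open Finset Literature.Combinatorics.Sahi2008 SahiHitting
open Literature.Probability.Percolation.DecisionTree (ind ind_of_mem ind_of_not_mem ind_nonneg)
open Literature.Probability.LatticeModels (prodBernoulli prodBernoulli_real_forall_notMem)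

variable {ι : Type*} [Fintype ι] [DecidableEq ι]

/-! ## Regions and the cell map -/

/-- The slot type of a coin: the set of `j` with `c ∈ A j`. [this work] -/
def ctype3 (A : Fin 3 → Finset ι) (c : ι) : Finset (Fin 3) := univ.filter fun j => c ∈ A j

/-- Region `i`: the coins whose slot type is `regs i`. [this work] -/
def region (A : Fin 3 → Finset ι) (i : Fin 7) : Finset ι := univ.filter fun c => ctype3 A c = regs i

/-- The region closed-probabilities `rr_i = ∏_{c ∈ region i} (1 − p_c)`. [this work] -/
def rr (p : ι → unitInterval) (A : Fin 3 → Finset ι) (i : Fin 7) : ℝ := ∏ c ∈ region A i, (1 - (p c : ℝ))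

/-- `rr_i ∈ [0,1]`. [this work] -/
theorem rr_mem_unit (p : ι → unitInterval) (A : Fin 3 → Finset ι) (i : Fin 7) : 0 ≤ rr p A i ∧ rr p A i ≤ 1 :=
  ⟨prod_nonneg fun c _ => sub_nonneg.2 (p c).2.2, prod_le_one (fun c _ => sub_nonneg.2 (p c).2.2) fun c _ => sub_le_self _ (p c).2.1⟩

open Classical in
/-- The cell map: the set of regions containing an open coin of `ω`. [this work] -/
noncomputable def rho (A : Fin 3 → Finset ι) (ω : Set ι) : Finset (Fin 7) := univ.filter fun i => ∃ c ∈ region A i, c ∈ ω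

/-- Membership in `rho`. [this work] -/
theorem mem_rho (A : Fin 3 → Finset ι) (ω : Set ι) (i : Fin 7) : i ∈ rho A ω ↔ ∃ c ∈ region A i, c ∈ ω := by
  classical
  simp [rho]

/-- Every nonempty slot set is one of the seven regions' types. [this work] -/
theorem exists_regs_eq (S : Finset (Fin 3)) (hS : S.Nonempty) : ∃ i : Fin 7, regs i = S := by
  revert hS
  revert S
  decide

/-- Regions are disjoint. [this work] -/
theorem region_disjoint (A : Fin 3 → Finset ι) {i j : Fin 7} (h : i ≠ j) : Disjoint (region A i) (region A j) := by
  rw [Finset.disjoint_left]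
  intro c hi hj
  simp only [region, mem_filter, mem_univ, true_and] at hi hj
  have hinj : Function.Injective regs := by decide
  exact h (hinj (hi.symm.trans hj))

/-- **The hit indicators factor through the cells**: `(∃ a ∈ A j, a ∈ ω) ↔ j ∈ patt (rho A ω)`. [this work] -/
theorem hit_iff_mem_patt_rho (A : Fin 3 → Finset ι) (ω : Set ι) (j : Fin 3) :
    (∃ a ∈ A j, a ∈ ω) ↔ j ∈ patt (rho A ω) := by
  rw [patt, mem_biUnion]
  constructor
  · rintro ⟨a, haj, haω⟩
    have hne : (ctype3 A a).Nonempty := ⟨j, by simp [ctype3, haj]⟩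
    obtain ⟨i, hi⟩ := exists_regs_eq _ hne
    refine ⟨i, (mem_rho A ω i).2 ⟨a, by simp [region, hi], haω⟩, ?_⟩
    rw [hi]; simp [ctype3, haj]
  · rintro ⟨i, hi, hji⟩
    obtain ⟨c, hc, hcω⟩ := (mem_rho A ω i).1 hi
    simp only [region, mem_filter, mem_univ, true_and] at hc
    rw [← hc] at hji
    simp only [ctype3, mem_filter, mem_univ, true_and] at hji
    exact ⟨c, hji, hcω⟩

/-- The slot indicator on the cells: `γ_j(R) = [j ∈ patt R]`. [this work] -/
noncomputable def gam (j : Fin 3) (R : Finset (Fin 7)) : ℝ := if j ∈ patt R then 1 else 0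

/-- `1_{H_{A_j}} = γ_j ∘ rho`. [this work] -/
theorem ind_hit_eq_gam_rho (A : Fin 3 → Finset ι) (j : Fin 3) (ω : Set ι) :
    ind {ω : Set ι | ∃ a ∈ A j, a ∈ ω} ω = gam j (rho A ω) := by
  unfold gam
  by_cases h : ∃ a ∈ A j, a ∈ ω
  · rw [ind_of_mem (show ω ∈ {ω : Set ι | ∃ a ∈ A j, a ∈ ω} from h), if_pos ((hit_iff_mem_patt_rho A ω j).1 h)]
  · rw [ind_of_not_mem (show ω ∉ {ω : Set ι | ∃ a ∈ A j, a ∈ ω} from h),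
      if_neg (fun h' => h ((hit_iff_mem_patt_rho A ω j).2 h'))]

/-! ## Cell masses -/

/-- The miss indicator of region `i`. [this work] -/
noncomputable def missInd (A : Fin 3 → Finset ι) (i : Fin 7) (ω : Set ι) : ℝ := ind {ω : Set ι | ∀ c ∈ region A i, c ∉ ω} ω

/-- The cell indicator `1_{rho = R}`. [this work] -/
noncomputable def cellInd (A : Fin 3 → Finset ι) (R : Finset (Fin 7)) (ω : Set ι) : ℝ := if rho A ω = R then 1 else 0

/-- Region `i` is missed iff `i ∉ rho ω`. [this work] -/
theorem missInd_eq (A : Fin 3 → Finset ι) (i : Fin 7) (ω : Set ι) : missInd A i ω = if i ∈ rho A ω then 0 else 1 := by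
  unfold missInd
  by_cases h : i ∈ rho A ω
  · rw [if_pos h, ind_of_not_mem]
    intro hmiss
    obtain ⟨c, hc, hcω⟩ := (mem_rho A ω i).1 h
    exact hmiss c hc hcω
  · rw [if_neg h, ind_of_mem]
    intro c hc hcω
    exact h ((mem_rho A ω i).2 ⟨c, hc, hcω⟩)

/-- The cell indicator is the product of hit/miss factors over the seven regions. [this work] -/
theorem cellInd_eq_prod (A : Fin 3 → Finset ι) (R : Finset (Fin 7)) (ω : Set ι) :
    cellInd A R ω = ∏ i, (if i ∈ R then 1 - missInd A i ω else missInd A i ω) := by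
  simp only [cellInd, missInd_eq]
  by_cases h : rho A ω = R
  · rw [if_pos h]
    symm
    refine prod_eq_one fun i _ => ?_
    rw [← h]
    by_cases hi : i ∈ rho A ω <;> simp [hi]
  · rw [if_neg h]
    symm
    -- some region disagrees
    have : ∃ i, ¬ (i ∈ R ↔ i ∈ rho A ω) := by
      by_contra hall
      push Not at hall
      exact h (Finset.ext fun i => (hall i).symm)
    obtain ⟨i, hi⟩ := this
    refine prod_eq_zero (mem_univ i) ?_
    by_cases hiR : i ∈ R
    · have hir : i ∉ rho A ω := fun hir => hi ⟨fun _ => hir, fun _ => hiR⟩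
      simp [hiR, hir]
    · have hir : i ∈ rho A ω := by
        by_contra hir; exact hi ⟨fun h1 => absurd h1 hiR, fun h2 => absurd h2 hir⟩
      simp [hiR, hir]

/-- Inclusion–exclusion of the hit/miss product (in `ℝ`). [folklore] -/
theorem prod_ite_one_sub_eq (m : Fin 7 → ℝ) (R : Finset (Fin 7)) :
    ∏ i, (if i ∈ R then 1 - m i else m i) = ∑ T ∈ R.powerset, (-1 : ℝ) ^ T.card * ∏ i ∈ T ∪ Rᶜ, m i := by
  rw [prod_ite]
  have h1 : (univ.filter fun i => i ∈ R) = R := by ext i; simp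
  have h2 : (univ.filter fun i => ¬ i ∈ R) = Rᶜ := by ext i; simp
  rw [h1, h2]
  have h3 : ∏ i ∈ R, (1 - m i) = ∑ T ∈ R.powerset, (-1 : ℝ) ^ T.card * ∏ i ∈ T, m i := by
    have : ∏ i ∈ R, (1 - m i) = ∏ i ∈ R, (-m i + 1) := prod_congr rfl fun i _ => by ring
    rw [this, prod_add]
    refine sum_congr rfl fun T _ => ?_
    rw [prod_const_one, mul_one, prod_neg]
  rw [h3, sum_mul]
  refine sum_congr rfl fun T hT => ?_
  rw [mem_powerset] at hT
  rw [mul_assoc, prod_union (disjoint_compl_right.mono_left hT)]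

/-- The product of the miss indicators of a set of regions is the miss indicator of their union. [this work] -/
theorem prod_missInd_eq (A : Fin 3 → Finset ι) (Q : Finset (Fin 7)) (ω : Set ι) :
    ∏ i ∈ Q, missInd A i ω = ind {ω : Set ι | ∀ c ∈ Q.biUnion (region A), c ∉ ω} ω := by
  unfold missInd
  exact prod_ind_miss_apply (region A) Q ω

/-- The miss probability of a set of regions. [this work] -/
theorem ex_prod_missInd (p : ι → unitInterval) (A : Fin 3 → Finset ι) (Q : Finset (Fin 7)) :
    ex (bernoulliWeight p) (fun ω => ∏ i ∈ Q, missInd A i ω) = ∏ i ∈ Q, rr p A i := by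
  have hfun : (fun ω => ∏ i ∈ Q, missInd A i ω) = ind {ω : Set ι | ∀ c ∈ Q.biUnion (region A), c ∉ ω} :=
    funext fun ω => prod_missInd_eq A Q ω
  rw [hfun, ex_bernoulliWeight_ind, prodBernoulli_real_forall_notMem]
  rw [prod_biUnion fun i _ j _ hij => region_disjoint A hij]
  rfl

/-- **Cell masses**: `E[1_{rho = R}] = cellProb (rr p A) R`. [this work] -/
theorem ex_cellInd (p : ι → unitInterval) (A : Fin 3 → Finset ι) (R : Finset (Fin 7)) :
    ex (bernoulliWeight p) (cellInd A R) = cellProb (rr p A) R := by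
  have hfun : cellInd A R = fun ω => ∑ T ∈ R.powerset, (-1 : ℝ) ^ T.card * ∏ i ∈ T ∪ Rᶜ, missInd A i ω := by
    funext ω; rw [cellInd_eq_prod, prod_ite_one_sub_eq]
  rw [hfun, ex_finset_sum]
  simp only [ex_const_mul, ex_prod_missInd]
  rw [cellProb, prod_ite_one_sub_eq]

/-! ## Pinning -/

omit [DecidableEq ι] in
/-- **One-coin pinning**: if `g(ω) ≤ g(ω ∪ {a})` for all `ω`, then `E[g·1_{a ∉ ω}] ≤ (1 − p_a)·E[g]`. [this work] -/
theorem ex_mul_notMem_le (p : ι → unitInterval) (a : ι) (g : Set ι → ℝ) (hg : ∀ ω, g ω ≤ g (insert a ω)) :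
    ex (bernoulliWeight p) (fun ω => g ω * ind {ω : Set ι | a ∉ ω} ω) ≤ (1 - (p a : ℝ)) * ex (bernoulliWeight p) g := by
  classical
  have h1 := ex_update_eq p a (p a) (fun ω => g ω * ind {ω : Set ι | a ∉ ω} ω)
  have h2 := ex_update_eq p a (p a) g
  simp only [Function.update_eq_self] at h1 h2
  rw [h1, h2]
  -- section moments of `g · 1_{a ∉ ·}`
  have s1 : secEx p a (fun ω => g ω * ind {ω : Set ι | a ∉ ω} ω) true = 0 := by
    unfold secEx
    refine sum_eq_zero fun ω _ => ?_
    simp only [if_true]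
    rw [ind_of_not_mem (show insert a ω ∉ {ω : Set ι | a ∉ ω} from fun h => h (Set.mem_insert a ω))]
    ring
  have s0 : secEx p a (fun ω => g ω * ind {ω : Set ι | a ∉ ω} ω) false = secEx p a g false := by
    unfold secEx
    refine sum_congr rfl fun ω hω => ?_
    rw [mem_filter] at hω
    simp only [Bool.false_eq_true, if_false]
    rw [ind_of_mem (show ω ∈ {ω : Set ι | a ∉ ω} from hω.2), mul_one]
  -- `X₀(g) ≤ X₁(g)`
  have hle : secEx p a g false ≤ secEx p a g true := by
    unfold secEx
    refine sum_le_sum fun ω _ => ?_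
    simp only [Bool.false_eq_true, if_false, if_true]
    exact mul_le_mul_of_nonneg_left (hg ω) (offWeight_nonneg p a ω)
  rw [s1, s0, mul_zero, zero_add]
  have hp0 : 0 ≤ (p a : ℝ) := (p a).2.1
  have hp1 : 0 ≤ 1 - (p a : ℝ) := sub_nonneg.2 (p a).2.2
  nlinarith [mul_le_mul_of_nonneg_left hle hp0]

/-- **Pinning a set of coins**: if `g(ω) ≤ g(ω ∪ {c})` for every `c ∈ S` and all `ω`, then
`E[g·1_{S closed}] ≤ (∏_{c∈S}(1 − p_c))·E[g]`. [this work] -/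
theorem ex_mul_missSet_le (p : ι → unitInterval) (S : Finset ι) (g : Set ι → ℝ) (hg : ∀ c ∈ S, ∀ ω, g ω ≤ g (insert c ω)) :
    ex (bernoulliWeight p) (fun ω => g ω * ind {ω : Set ι | ∀ c ∈ S, c ∉ ω} ω) ≤ (∏ c ∈ S, (1 - (p c : ℝ))) * ex (bernoulliWeight p) g := by
  induction S using Finset.induction_on generalizing g with
  | empty =>
    rw [prod_empty, one_mul]
    refine le_of_eq (congrArg _ (funext fun ω => ?_))
    rw [ind_of_mem (show ω ∈ {ω : Set ι | ∀ c ∈ (∅ : Finset ι), c ∉ ω} from fun c hc => absurd hc (Finset.notMem_empty c)), mul_one]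
  | insert a S haS ih =>
    -- split `1_{insert a S closed} = 1_{S closed} · 1_{a ∉ ω}`
    have hsplit : (fun ω => g ω * ind {ω : Set ι | ∀ c ∈ insert a S, c ∉ ω} ω)
        = fun ω => (g ω * ind {ω : Set ι | ∀ c ∈ S, c ∉ ω} ω) * ind {ω : Set ι | a ∉ ω} ω := by
      funext ω
      by_cases ha : a ∈ ω
      · rw [ind_of_not_mem (show ω ∉ {ω : Set ι | a ∉ ω} from fun h => h ha),
          ind_of_not_mem (show ω ∉ {ω : Set ι | ∀ c ∈ insert a S, c ∉ ω} from fun h => h a (mem_insert_self a S) ha)]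
        ring
      · rw [ind_of_mem (show ω ∈ {ω : Set ι | a ∉ ω} from ha), mul_one]
        by_cases hS : ∀ c ∈ S, c ∉ ω
        · rw [ind_of_mem (show ω ∈ {ω : Set ι | ∀ c ∈ S, c ∉ ω} from hS),
            ind_of_mem (show ω ∈ {ω : Set ι | ∀ c ∈ insert a S, c ∉ ω} from fun c hc => by
              rcases mem_insert.1 hc with rfl | hc
              · exact ha
              · exact hS c hc)]
        · rw [ind_of_not_mem (show ω ∉ {ω : Set ι | ∀ c ∈ S, c ∉ ω} from hS),
            ind_of_not_mem (show ω ∉ {ω : Set ι | ∀ c ∈ insert a S, c ∉ ω} from fun h => hS fun c hc => h c (mem_insert_of_mem hc))]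
    rw [hsplit]
    -- the function `g · 1_{S closed}` is still increasing in the coin `a ∉ S`
    have hg' : ∀ ω, g ω * ind {ω : Set ι | ∀ c ∈ S, c ∉ ω} ω ≤ g (insert a ω) * ind {ω : Set ι | ∀ c ∈ S, c ∉ ω} (insert a ω) := by
      intro ω
      have hind : ind {ω : Set ι | ∀ c ∈ S, c ∉ ω} (insert a ω) = ind {ω : Set ι | ∀ c ∈ S, c ∉ ω} ω := by
        by_cases hS : ∀ c ∈ S, c ∉ ω
        · rw [ind_of_mem (show ω ∈ {ω : Set ι | ∀ c ∈ S, c ∉ ω} from hS),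
            ind_of_mem (show insert a ω ∈ {ω : Set ι | ∀ c ∈ S, c ∉ ω} from fun c hc h => by
              rcases Set.mem_insert_iff.1 h with rfl | h
              · exact haS hc
              · exact hS c hc h)]
        · rw [ind_of_not_mem (show ω ∉ {ω : Set ι | ∀ c ∈ S, c ∉ ω} from hS),
            ind_of_not_mem (show insert a ω ∉ {ω : Set ι | ∀ c ∈ S, c ∉ ω} from fun h => hS fun c hc hcω => h c hc (Set.mem_insert_of_mem a hcω))]
      rw [hind]
      exact mul_le_mul_of_nonneg_right (hg a (mem_insert_self a S) ω) (ind_nonneg _ _)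
    refine le_trans (ex_mul_notMem_le p a _ hg') ?_
    rw [prod_insert haS, mul_assoc]
    refine mul_le_mul_of_nonneg_left (ih g fun c hc => hg c (mem_insert_of_mem hc)) (sub_nonneg.2 (p a).2.2)

end SahiFreeSlot

end Summit.CriticalPhenomena.PercolationContinuityZ3.Theorems
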